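import Mathlib.Logic.Equiv.Fin.Basic
import Mathlib.Logic.Equiv.Option
import Mathlib.Algebra.BigOperators.Fin
import Mathlib.Order.Interval.Finset.Fin
import Literature.Computability.AlgebraicComplexity.NilCoxeterTensor
import Literature.Computability.AlgebraicComplexity.BorderRankRestriction
import HarnessLib

/-!
# The parabolic decomposition `S_{n+1} = S_n · {c_p}` and the nil-Coxeter tensor along the tower `NC_n ⊂ NC_{n+1}`

Topic `Literature/Computability/AlgebraicComplexity` (companion of `NilCoxeterTensor.lean`; wanted by route
`MatrixMultiplication/NilCoxeterShadow`, items `stmt-MatrixMultiplication-0956/0958`, whose inductive engine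
runs along the parabolic tower). Everything here is PROVED.

* The **parabolic (minimal coset representative) parametrisation** of `S_{n+1}` by `Fin (n+1) × S_n`:
  `π[p, z]` is the permutation of `Fin (n+1)` with the largest value `last` at position `p` and the pattern
  `z ∈ S_n` on the remaining positions (`π[p, z] (p.succAbove i) = castSucc (z i)`), written with Mathlib's
  `finSuccEquiv'` / `Equiv.optionCongr` (no new definition). In Coxeter language `π[p, z] = ẑ · c_p` with
  `ẑ = π[last, z]` the standard embedding `S_n ⊂ S_{n+1}` and `c_p` the minimal-length representative of its
  coset, and lengths add: `inv π[p, z] = inv z + (n - p)` (`inversionNumber_parabolic`; Björner–Brenti 2005,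
  Prop. 2.4.4 with `J = S ∖ {s_n}`, and (1.25): inserting the letter `n+1` at position `p` creates exactly
  `n - p` inversions); `π[last, x] * π[q, y] = π[q, x * y]` (`parabolic_last_mul`) and `π` is injective.
* The **tensor shadow**: restricting the LEFT factor of `T_{NC_{n+1}}` to `S_n ⊂ S_{n+1}` and reading output
  and right factor in the coordinates `π[p, z]` gives exactly `n+1` block-diagonal copies of `T_{NC_n}`
  (`nilCoxeterTensor_parabolic`: `T_{NC_{n+1}}(π[p,z], π[last,x], π[q,y]) = [p = q] · T_{NC_n}(z, x, y)`), i.e.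
  `NC_{n+1} = ⊕_p NC_n · T_{c_p}` is a free left `NC_n`-module whose summands are permuted trivially.
* Consequences for the border rank over `K[ε]` (Bläser 2013, Def. 6.1): `bR((n+1) ⊙ T_{NC_n}) ≤ bR(T_{NC_{n+1}})`
  (`algBorderRank_parabolicCopies_le`, by `algBorderRank_precomp_le`) and monotonicity along the tower
  `bR(T_{NC_n}) ≤ bR(T_{NC_{n+1}})`, `bR(T_{NC_m}) ≤ bR(T_{NC_n})` for `m ≤ n`
  (`algBorderRank_nilCoxeterTensor_mono`, `algBorderRank_nilCoxeterTensor_le_of_le`).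

What is NOT here: any gain beyond the copies — the factor `n+1` itself would need border-rank additivity
of the `n+1` copies (false for general tensors, Schönhage 1981), and a super-linear excess is the open item
`InductiveCosetGrowth` of the route.

## References

* A. Björner, F. Brenti, *Combinatorics of Coxeter Groups*, GTM 231, Springer 2005: §2.4, Prop. 2.4.4
  (`w = w^J w_J`, `ℓ(w) = ℓ(w^J) + ℓ(w_J)`), §1.5 (1.25). [BjornerBrenti2005]
* M. Bläser, *Fast Matrix Multiplication*, Theory of Computing Graduate Surveys 5 (2013), Def. 6.1. [Blaser2013]
-/

noncomputable section

open scoped BigOperators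

namespace Literature.Computability.AlgebraicComplexity

variable {n : ℕ}

/-! ## The parabolic parametrisation of `S_{n+1}`

Throughout, `π[p, z]` in the prose abbreviates the Mathlib term
`(finSuccEquiv' p).trans ((Equiv.optionCongr z).trans (finSuccEquiv' (Fin.last n)).symm) : Equiv.Perm (Fin (n+1))`
(remove the position `p`, apply the pattern `z`, re-insert the removed point as the value `last`); the statements
spell it out (no notation, no new definition). -/

/-- `π[p, z] p = last`. [folklore] -/
@[simp] theorem parabolic_apply_self (p : Fin (n + 1)) (z : Equiv.Perm (Fin n)) :
    ((finSuccEquiv' (p)).trans ((Equiv.optionCongr (z)).trans (finSuccEquiv' (Fin.last n)).symm)) p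
          = Fin.last n := by
  simp

/-- `π[p, z] (p.succAbove i) = castSucc (z i)`. [folklore] -/
@[simp] theorem parabolic_apply_succAbove (p : Fin (n + 1)) (z : Equiv.Perm (Fin n)) (i : Fin n) :
    ((finSuccEquiv' (p)).trans ((Equiv.optionCongr (z)).trans (finSuccEquiv' (Fin.last n)).symm))
          (p.succAbove i) = Fin.castSucc (z i) := by
  simp

/-- Off the pivot the values of `π[p, z]` are below `last`. [folklore] -/
theorem parabolic_apply_lt_last (p : Fin (n + 1)) (z : Equiv.Perm (Fin n)) {j : Fin (n + 1)} (hj :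
      j ≠ p) :
    ((finSuccEquiv' (p)).trans ((Equiv.optionCongr (z)).trans (finSuccEquiv' (Fin.last n)).symm)) j
          < Fin.last n := by
  rcases Fin.eq_self_or_eq_succAbove p j with rfl | ⟨i, rfl⟩
  · exact absurd rfl hj
  · rw [parabolic_apply_succAbove]
    exact Fin.castSucc_lt_last _

/-- **Lengths add along the parabolic decomposition**: `inv π[p, z] = inv z + (n - p)` — the letter `last`
at position `p` is inverted exactly with the `n - p` positions to its right, and the remaining inversions are
those of the pattern `z` (Björner–Brenti 2005, Prop. 2.4.4: `ℓ(w) = ℓ(w_J) + ℓ(w^J)` for the minimal coset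
representative; (1.25)). [cite: BjornerBrenti2005, Prop. 2.4.4] -/
theorem inversionNumber_parabolic (p : Fin (n + 1)) (z : Equiv.Perm (Fin n)) :
    inversionNumber ((finSuccEquiv' (p)).trans ((Equiv.optionCongr (z)).trans (finSuccEquiv'
          (Fin.last n)).symm)) = inversionNumber z + (n - p) := by
  set w : Equiv.Perm (Fin (n + 1)) := ((finSuccEquiv' (p)).trans ((Equiv.optionCongr (z)).trans
        (finSuccEquiv' (Fin.last n)).symm)) with hw
  have hwp : w p = Fin.last n := parabolic_apply_self p z
  have hws : ∀ i, w (p.succAbove i) = Fin.castSucc (z i) := parabolic_apply_succAbove p z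
  -- both inversion numbers as double sums of indicators
  have hsum : ∀ {m : ℕ} (v : Equiv.Perm (Fin m)), inversionNumber v =
      ∑ i, ∑ j, (if i < j ∧ v j < v i then 1 else 0) := by
    intro m v
    rw [inversionNumber, Finset.card_filter, ← Finset.univ_product_univ, Finset.sum_product]
  rw [hsum w, hsum z, Fin.sum_univ_succAbove _ p]
  -- the row of the pivot: `last` is inverted with every position to its right
  have hrow : (∑ j, if p < j ∧ w j < w p then 1 else 0) = n - p := by
    have : ∀ j, (p < j ∧ w j < w p) ↔ p < j := by
      intro j
      refine ⟨fun h => h.1, fun h => ⟨h, ?_⟩⟩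
      rw [hwp]
      exact parabolic_apply_lt_last p z (ne_of_gt h)
    simp_rw [this]
    rw [← Finset.card_filter, Finset.filter_lt_eq_Ioi, Fin.card_Ioi]
    omega
  -- the other rows: the pivot column contributes nothing, the rest is the pattern `z`
  have hrest : ∀ i : Fin n, (∑ j, if p.succAbove i < j ∧ w j < w (p.succAbove i) then 1 else 0) =
      ∑ j : Fin n, (if i < j ∧ z j < z i then 1 else 0) := by
    intro i
    rw [Fin.sum_univ_succAbove _ p]
    have h0 : (if p.succAbove i < p ∧ w p < w (p.succAbove i) then 1 else 0) = 0 := by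
      rw [if_neg]
      rintro ⟨-, h⟩
      rw [hwp, hws] at h
      exact absurd h (not_lt.2 (Fin.castSucc_lt_last _).le)
    rw [h0, zero_add]
    refine Finset.sum_congr rfl fun j _ => ?_
    rw [hws, hws]
    exact if_congr (Iff.and Fin.succAbove_lt_succAbove_iff Fin.castSucc_lt_castSucc_iff) rfl rfl
  simp_rw [hrest]
  rw [hrow]
  ring

/-- **Left multiplication by `S_n` acts on the pattern**: `π[last, x] * π[q, y] = π[q, x * y]` (the
embedded `x̂ = π[last, x]` fixes the letter `last` and permutes the smaller letters). [folklore] -/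
theorem parabolic_last_mul (x : Equiv.Perm (Fin n)) (q : Fin (n + 1)) (y : Equiv.Perm (Fin n)) :
    (((finSuccEquiv' (Fin.last n)).trans ((Equiv.optionCongr (x)).trans (finSuccEquiv' (Fin.last
          n)).symm))) * (((finSuccEquiv' (q)).trans ((Equiv.optionCongr (y)).trans (finSuccEquiv'
          (Fin.last n)).symm))) = ((finSuccEquiv' (q)).trans ((Equiv.optionCongr (x * y)).trans
          (finSuccEquiv' (Fin.last n)).symm)) := by
  ext j : 1
  rw [Equiv.Perm.mul_apply]
  rcases Fin.eq_self_or_eq_succAbove q j with rfl | ⟨i, rfl⟩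
  · rw [parabolic_apply_self, parabolic_apply_self, parabolic_apply_self]
  · rw [parabolic_apply_succAbove, parabolic_apply_succAbove, ← Fin.succAbove_last_apply,
      parabolic_apply_succAbove, Equiv.Perm.mul_apply]

/-- The pivot is recovered as the position of `last`. [folklore] -/
theorem parabolic_symm_last (p : Fin (n + 1)) (z : Equiv.Perm (Fin n)) :
    (((finSuccEquiv' (p)).trans ((Equiv.optionCongr (z)).trans (finSuccEquiv' (Fin.last
          n)).symm))).symm (Fin.last n) = p := by
  rw [Equiv.symm_apply_eq]
  exact (parabolic_apply_self p z).symm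

/-- **The parametrisation is injective** (hence bijective, `|S_{n+1}| = (n+1) · |S_n|`): the pivot is the
position of `last`, the pattern is read off the other positions. [folklore] -/
theorem parabolic_injective {p p' : Fin (n + 1)} {z z' : Equiv.Perm (Fin n)}
    (h : (((finSuccEquiv' (p)).trans ((Equiv.optionCongr (z)).trans (finSuccEquiv' (Fin.last
          n)).symm))) = ((finSuccEquiv' (p')).trans ((Equiv.optionCongr (z')).trans (finSuccEquiv'
          (Fin.last n)).symm))) : p = p' ∧ z = z' := by
  have hp : p = p' := by
    rw [← parabolic_symm_last p z, ← parabolic_symm_last p' z', h]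
  subst hp
  refine ⟨rfl, ?_⟩
  ext i : 1
  have := congrArg (fun w : Equiv.Perm (Fin (n + 1)) => w (p.succAbove i)) h
  simpa [parabolic_apply_succAbove] using this

/-! ## The nil-Coxeter tensor along the tower -/

section Tensor

variable (K : Type*) [CommSemiring K]

/-- **Parabolic restriction of the nil-Coxeter tensor.** With output and right factor in the coordinates
`π[p, z]`, `π[q, y]` and the left factor restricted to `S_n = {π[last, x]}`:
`T_{NC_{n+1}}(π[p,z], π[last,x], π[q,y]) = [p = q] · T_{NC_n}(z, x, y)` — the `n+1` coset layers
`NC_n · T_{c_p}` of the free left `NC_n`-module `NC_{n+1}` are preserved by left multiplication, each carrying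
a copy of the multiplication table of `NC_n` (lengths add along the decomposition,
`inversionNumber_parabolic`). [cite: BjornerBrenti2005, Prop. 2.4.4] -/
theorem nilCoxeterTensor_parabolic (p q : Fin (n + 1)) (z x y : Equiv.Perm (Fin n)) :
    nilCoxeterTensor K (n + 1) (((finSuccEquiv' (p)).trans ((Equiv.optionCongr (z)).trans
          (finSuccEquiv' (Fin.last n)).symm))) (((finSuccEquiv' (Fin.last n)).trans
          ((Equiv.optionCongr (x)).trans (finSuccEquiv' (Fin.last n)).symm))) (((finSuccEquiv'
          (q)).trans ((Equiv.optionCongr (y)).trans (finSuccEquiv' (Fin.last n)).symm))) =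
      if p = q then nilCoxeterTensor K n z x y else 0 := by
  rw [nilCoxeterTensor_apply, nilCoxeterTensor_apply, parabolic_last_mul, inversionNumber_parabolic,
    inversionNumber_parabolic, inversionNumber_parabolic]
  simp only [Fin.val_last, Nat.sub_self, add_zero]
  by_cases hpq : p = q
  · subst hpq
    rw [if_pos rfl]
    refine if_congr ⟨fun h => ?_, fun h => ?_⟩ rfl rfl
    · have h1 := (parabolic_injective h.1).2
      exact ⟨h1, by omega⟩
    · rw [h.1]
      exact ⟨rfl, by omega⟩
  · rw [if_neg hpq, if_neg]
    rintro ⟨h, -⟩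
    exact hpq (parabolic_injective h).1.symm

/-- **`bR((n+1) ⊙ T_{NC_n}) ≤ bR(T_{NC_{n+1}})`**: the direct sum of `n+1` copies of `T_{NC_n}` (block-diagonal in
the coset index on output and right factor) is the relabelling of `T_{NC_{n+1}}` along
`(p, z) ↦ π[p, z]`, `x ↦ π[last, x]`, so its border rank over `K[ε]` is at most that of `T_{NC_{n+1}}`
(`algBorderRank_precomp_le`). [cite: Blaser2013, Def. 6.1] -/
theorem algBorderRank_parabolicCopies_le (n : ℕ) :
    algBorderRank (fun (a : Fin (n + 1) × Equiv.Perm (Fin n)) (x : Equiv.Perm (Fin n))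
        (c : Fin (n + 1) × Equiv.Perm (Fin n)) => if a.1 = c.1 then nilCoxeterTensor K n a.2 x c.2
              else 0) ≤
      algBorderRank (nilCoxeterTensor K (n + 1)) := by
  have key := algBorderRank_precomp_le (nilCoxeterTensor K (n + 1))
    (fun a : Fin (n + 1) × Equiv.Perm (Fin n) => (((finSuccEquiv' (a.1)).trans ((Equiv.optionCongr
          (a.2)).trans (finSuccEquiv' (Fin.last n)).symm)) : Equiv.Perm (Fin (n + 1))))
    (fun x : Equiv.Perm (Fin n) => (((finSuccEquiv' (Fin.last n)).trans ((Equiv.optionCongr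
          (x)).trans (finSuccEquiv' (Fin.last n)).symm)) : Equiv.Perm (Fin (n + 1))))
    (fun c : Fin (n + 1) × Equiv.Perm (Fin n) => (((finSuccEquiv' (c.1)).trans ((Equiv.optionCongr
          (c.2)).trans (finSuccEquiv' (Fin.last n)).symm)) : Equiv.Perm (Fin (n + 1))))
  simp only [nilCoxeterTensor_parabolic] at key
  exact key

/-- **Monotonicity along the tower `bR(T_{NC_n}) ≤ bR(T_{NC_{n+1}})`**: `T_{NC_n}` is the coset layer `p = q = last`
of the parabolic restriction (equivalently: the structure tensor of the subalgebra `NC_n ⊂ NC_{n+1}` is a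
restriction of that of `NC_{n+1}`). [cite: Blaser2013, Def. 6.1] -/
theorem algBorderRank_nilCoxeterTensor_mono (n : ℕ) :
    algBorderRank (nilCoxeterTensor K n) ≤ algBorderRank (nilCoxeterTensor K (n + 1)) := by
  have key := algBorderRank_precomp_le (nilCoxeterTensor K (n + 1))
    (fun z : Equiv.Perm (Fin n) => (((finSuccEquiv' (Fin.last n)).trans ((Equiv.optionCongr
          (z)).trans (finSuccEquiv' (Fin.last n)).symm)) : Equiv.Perm (Fin (n + 1))))
    (fun x : Equiv.Perm (Fin n) => (((finSuccEquiv' (Fin.last n)).trans ((Equiv.optionCongr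
          (x)).trans (finSuccEquiv' (Fin.last n)).symm)) : Equiv.Perm (Fin (n + 1))))
    (fun y : Equiv.Perm (Fin n) => (((finSuccEquiv' (Fin.last n)).trans ((Equiv.optionCongr
          (y)).trans (finSuccEquiv' (Fin.last n)).symm)) : Equiv.Perm (Fin (n + 1))))
  simp only [nilCoxeterTensor_parabolic, if_true] at key
  exact key

/-- `bR(T_{NC_m}) ≤ bR(T_{NC_n})` for `m ≤ n` (iterate `algBorderRank_nilCoxeterTensor_mono`). [cite: Blaser2013, Def. 6.1] -/
theorem algBorderRank_nilCoxeterTensor_le_of_le {m n : ℕ} (h : m ≤ n) :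
    algBorderRank (nilCoxeterTensor K m) ≤ algBorderRank (nilCoxeterTensor K n) := by
  induction h with
  | refl => exact le_rfl
  | step _ ih => exact ih.trans (algBorderRank_nilCoxeterTensor_mono K _)

end Tensor

end Literature.Computability.AlgebraicComplexity

end
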